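import Literature.NumberTheory.Automorphic.UnitaryGroupTruncatedKernelClassIntegrableOfCusp
import Literature.NumberTheory.Automorphic.UnitaryGroupKernelOffBorelVanishing
import Literature.NumberTheory.Automorphic.UnitaryGroupMahlerRegion
import Literature.NumberTheory.Automorphic.UnitaryGroupKernelFiniteSum
import Literature.MeasureTheory.Group.InvariantQuotientConjugacySum
import HarnessLib

/-!
# The class kernel of an ELLIPTIC class of `U(J₃)` is bounded and vanishes high in the cusp:
# `∫_{G(F)\G(𝔸)} Σ_{γ ∈ 𝔬} |f(x γ x⁻¹)| dμ(x) < ∞`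

(Arthur, *A trace formula for reductive groups I*, Duke Math. J. 45 (1978), §8: for a class `𝔬` meeting no
proper parabolic, `x ↦ K_𝔬(x,x)` is compactly supported modulo `G(F)`; Rogawski (1990), §2.2–2.3 p. 13–14;
Gelbart (1975), (9.12)–(9.14) for the anisotropic picture.)

Topic `NumberTheory/Automorphic`; namespace `Literature.NumberTheory.Automorphic.UnitaryGroup`. THEOREMS ONLY
(no definition, no named fact, no instance, no notation, no `sorry`). Brick (L4-e) of the T1-qs LAW 4 road
(«the elliptic terms are orbital integrals») of `Cruxes/H413/Lines/F0_T1InnerFormTraceIdentity.lean` (cell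
`pub/hodgecm-mathlib`, crux H413): the ANALYTIC input of the unfolding — absolute convergence — for a class
`𝔬 = cl⁻¹{i}` that MISSES the rational Borel (`hi : ∀ β ∈ B(F), cl β ≠ i`; conjugation-invariant `cl`).

* `borelHeight_le_of_apply_conj_ne_zero_of_forall_ne` — if `f(g γ g⁻¹) ≠ 0` for some `γ ∈ 𝔬` then
  `H(δ g⁻¹) ≤ c₀` for EVERY `δ ∈ G(F)` (★ `exists_borelHeight_le_of_conj_mem_of_not_mem_arithmeticBorel`: no
  conjugate of `γ` lies in `B(F)`), so `g⁻¹` lies in Mahler's region (★ `forall_inv_le_vecHeight_of_forall_borelHeight_le`,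
  ★ `exists_isCompact_forall_exists_toAdelic_mul_mem`): `g ∈ Kc⁻¹ · G(F)`;
* **`exists_forall_conjTsum_fiber_enorm_le`** — the descended class sum `x ↦ Σ_{γ ∈ 𝔬} ‖f(x γ x⁻¹)‖ₑ` on
  `G(𝔸) ⧸ G(F)` (★ `conjTsum`) is BOUNDED by `#{γ ∈ G(F) ∩ Kc · supp f · Kc⁻¹} · sup ‖f‖`;
* **`lintegral_conjTsum_fiber_enorm_lt_top`** — hence `∫⁻ conjTsum_𝔬 ‖f‖ₑ dμ < ∞` for every automorphic
  (finite, invariant) `μ` and every continuous compactly supported `f`: the hypothesis `hfin` of the per-class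
  unfolding (L4-c-ii).

## References
* J. Arthur, *A trace formula for reductive groups I*, Duke Math. J. 45 (1978), §8 [Arthur1978TraceFormulaI].
* J. D. Rogawski, *Automorphic Representations of Unitary Groups in Three Variables*, Ann. of Math. Stud. 123
  (1990), §2.2–§2.3 (pp. 13–14) [Rogawski1990].
* S. Gelbart, *Automorphic forms on adele groups* (1975), (9.12)–(9.14) [Gelbart1975].
-/

set_option autoImplicit false

noncomputable section

open MeasureTheory Measure NumberField IsDedekindDomain Set
open Literature.MeasureTheory.Group
open scoped NNReal ENNReal Pointwise MatrixGroups

namespace Literature.NumberTheory.Automorphic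

namespace UnitaryGroup

variable {F E : Type} [Field F] [NumberField F] [Field E] [NumberField E] [Algebra F E]
  {c : E ≃ₐ[F] E} {ι : Type*}

/-- **Elliptic classes stay low in the cusp.**  Let `cl` be conjugation invariant and the class `i` miss `B(F)`.
With `c₀` the constant of ★ `exists_borelHeight_le_of_conj_mem_of_not_mem_arithmeticBorel` for `Ω = tsupport f`:
if `f(g γ g⁻¹) ≠ 0` for some `γ ∈ G(F)` with `cl γ = i`, then `H(δ g⁻¹) ≤ c₀` for every `δ ∈ G(F)`
(apply the lemma to `x = (g δ⁻¹)⁻¹`… i.e. to the conjugate `δ γ δ⁻¹ ∉ B(F)`). [cite: Arthur1978TraceFormulaI, §8] -/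
theorem borelHeight_le_of_apply_conj_ne_zero_of_forall_ne
    {cl : (quasiSplit F E c 3).arithmeticSubgroup → ι} (hcl : IsConjInvariant cl) {i : ι}
    (hi : ∀ β : (quasiSplit F E c 3).arithmeticSubgroup, β ∈ arithmeticBorel F E c 3 → cl β ≠ i)
    {f : (quasiSplit F E c 3).Adelic → ℂ} {c₀ : ℝ≥0}
    (hc₀ : ∀ (g : (quasiSplit F E c 3).Adelic) (γ : (quasiSplit F E c 3).arithmeticSubgroup),
      γ ∉ arithmeticBorel F E c 3 → g⁻¹ * (γ : (quasiSplit F E c 3).Adelic) * g ∈ tsupport f → borelHeight g ≤ c₀)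
    {g : (quasiSplit F E c 3).Adelic} {γ : (quasiSplit F E c 3).arithmeticSubgroup} (hγ : cl γ = i)
    (hne : f (g * (γ : (quasiSplit F E c 3).Adelic) * g⁻¹) ≠ 0)
    (δ : (quasiSplit F E c 3).arithmeticSubgroup) :
    borelHeight ((δ : (quasiSplit F E c 3).Adelic) * g⁻¹) ≤ c₀ := by
  have hmem : g * (γ : (quasiSplit F E c 3).Adelic) * g⁻¹ ∈ tsupport f := subset_tsupport _ hne
  have hnotB : δ * γ * δ⁻¹ ∉ arithmeticBorel F E c 3 := fun hB => hi _ hB (by rw [hcl]; exact hγ)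
  refine hc₀ ((δ : (quasiSplit F E c 3).Adelic) * g⁻¹) (δ * γ * δ⁻¹) hnotB ?_
  have e : ((δ : (quasiSplit F E c 3).Adelic) * g⁻¹)⁻¹ * ((δ * γ * δ⁻¹ : (quasiSplit F E c 3).arithmeticSubgroup) :
      (quasiSplit F E c 3).Adelic) * ((δ : (quasiSplit F E c 3).Adelic) * g⁻¹) =
      g * (γ : (quasiSplit F E c 3).Adelic) * g⁻¹ := by
    simp only [Subgroup.coe_mul, Subgroup.coe_inv]
    group
  rw [e]
  exact hmem

/-- **THE CLASS SUM OF AN ELLIPTIC CLASS IS BOUNDED ON `G(𝔸) ⧸ G(F)`.**  For `f` continuous of compact support,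
`cl` conjugation invariant and a class `i` missing `B(F)`, the descended sum `x G(F) ↦ Σ_{γ ∈ G(F), cl γ = i}
‖f(x γ x⁻¹)‖ₑ` (★ `conjTsum` over the fibre, `L = G(F)`) is bounded: off Mahler's region it VANISHES (previous
lemma + ★ `forall_inv_le_vecHeight_of_forall_borelHeight_le` + ★ `exists_isCompact_forall_exists_toAdelic_mul_mem`),
and a representative `x ∈ Kc⁻¹` sees only the finitely many `γ ∈ G(F) ∩ Kc · supp f · Kc⁻¹` (★
`finite_setOf_mem_arithmeticSubgroup_of_isCompact`). [cite: Arthur1978TraceFormulaI, §8] [cite: Gelbart1975, (9.12)] -/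
theorem exists_forall_conjTsum_fiber_enorm_le (hc : c * c = 1)
    {cl : (quasiSplit F E c 3).arithmeticSubgroup → ι} (hcl : IsConjInvariant cl) {i : ι}
    (hi : ∀ β : (quasiSplit F E c 3).arithmeticSubgroup, β ∈ arithmeticBorel F E c 3 → cl β ≠ i)
    (hS : ∀ ℓ ∈ (quasiSplit F E c 3).quotientSubgroup,
      ∀ s ∈ ((↑) : (quasiSplit F E c 3).arithmeticSubgroup → (quasiSplit F E c 3).Adelic) '' (cl ⁻¹' {i}),
        ℓ * s * ℓ⁻¹ ∈ ((↑) : (quasiSplit F E c 3).arithmeticSubgroup → (quasiSplit F E c 3).Adelic) '' (cl ⁻¹' {i}))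
    {f : (quasiSplit F E c 3).Adelic → ℂ} (hfc : Continuous f) (hfs : HasCompactSupport f) :
    ∃ B : ℝ≥0∞, B ≠ ⊤ ∧ ∀ x : (quasiSplit F E c 3).Adelic ⧸ (quasiSplit F E c 3).quotientSubgroup,
      conjTsum (quasiSplit F E c 3).quotientSubgroup
        (((↑) : (quasiSplit F E c 3).arithmeticSubgroup → (quasiSplit F E c 3).Adelic) '' (cl ⁻¹' {i})) hS
        (fun g => (‖f g‖ₑ : ℝ≥0∞)) x ≤ B := by
  classical
  haveI := secondCountableTopology_adeleRing E
  haveI := locallyCompactSpace_adeleRing' E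
  haveI := t2Space_adeleRing_of_numberField E
  haveI : T2Space (quasiSplit F E c 3).Adelic :=
    inferInstanceAs (T2Space (adelic F E c 3 ((StdForm.antidiagonal 3).over E)))
  haveI : LocallyCompactSpace (quasiSplit F E c 3).Adelic :=
    inferInstanceAs (LocallyCompactSpace (adelic F E c 3 ((StdForm.antidiagonal 3).over E)))
  -- the height cut-off of the elliptic class and Mahler's compact set
  obtain ⟨c₀, hc₀⟩ := exists_borelHeight_le_of_conj_mem_of_not_mem_arithmeticBorel (c := c) hfs.isCompact
  set c₁ : ℝ≥0 := max c₀ 1 with hc₁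
  have hc₁1 : 1 ≤ c₁ := le_max_right _ _
  have hε : 0 < c₁⁻¹ := inv_pos.2 (lt_of_lt_of_le one_pos hc₁1)
  obtain ⟨Kc, hKc, hMahler⟩ := exists_isCompact_forall_exists_toAdelic_mul_mem (F := F) (E := E) (c := c) (N := 3) hε
  -- the finitely many rational elements conjugated into `supp f` by `Kc⁻¹`
  have hCc : IsCompact (Kc * tsupport f * Kc⁻¹) := (hKc.mul hfs.isCompact).mul hKc.inv
  have hTfin := finite_setOf_mem_arithmeticSubgroup_of_isCompact (N := 3) hCc 1 1
  set T : Finset (quasiSplit F E c 3).arithmeticSubgroup := hTfin.toFinset with hT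
  -- a bound for `f`
  obtain ⟨M, hM⟩ := hfs.exists_bound_of_continuous hfc
  refine ⟨(T.card : ℝ≥0∞) * ENNReal.ofReal M, ENNReal.mul_ne_top (ENNReal.natCast_ne_top _) ENNReal.ofReal_ne_top,
    fun x => ?_⟩
  induction x using QuotientGroup.induction_on with
  | H g => ?_
  rw [conjTsum_mk]
  by_cases h0 : ∑' s : (((↑) : (quasiSplit F E c 3).arithmeticSubgroup → (quasiSplit F E c 3).Adelic) '' (cl ⁻¹' {i})),
      (‖f (g * (s : (quasiSplit F E c 3).Adelic) * g⁻¹)‖ₑ : ℝ≥0∞) = 0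
  · rw [h0]; exact bot_le
  -- some term is non-zero: the class is seen by `g`, so `g⁻¹` is low in the cusp everywhere along `G(F)`
  obtain ⟨⟨s, γ, hγ, rfl⟩, hs⟩ : ∃ s : (((↑) : (quasiSplit F E c 3).arithmeticSubgroup →
      (quasiSplit F E c 3).Adelic) '' (cl ⁻¹' {i})), (‖f (g * (s : (quasiSplit F E c 3).Adelic) * g⁻¹)‖ₑ : ℝ≥0∞) ≠ 0 := by
    by_contra hall
    push Not at hall
    exact h0 (ENNReal.tsum_eq_zero.2 hall)
  have hne : f (g * (γ : (quasiSplit F E c 3).Adelic) * g⁻¹) ≠ 0 := by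
    intro h; exact hs (by rw [h, enorm_zero])
  have hlow : ∀ δ : (quasiSplit F E c 3).arithmeticSubgroup,
      borelHeight ((δ : (quasiSplit F E c 3).Adelic) * g⁻¹) ≤ c₁ :=
    fun δ => (borelHeight_le_of_apply_conj_ne_zero_of_forall_ne hcl hi hc₀ hγ hne δ).trans (le_max_left _ _)
  obtain ⟨γ₀, hγ₀⟩ := hMahler g⁻¹ (forall_inv_le_vecHeight_of_forall_borelHeight_le hc hc₁1 hlow)
  -- move the representative: `g G(F) = k⁻¹ G(F)` with `k := γ₀ g⁻¹ ∈ Kc`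
  set k : (quasiSplit F E c 3).Adelic := (quasiSplit F E c 3).toAdelic γ₀ * g⁻¹ with hk
  have hkg : (QuotientGroup.mk g : (quasiSplit F E c 3).Adelic ⧸ (quasiSplit F E c 3).quotientSubgroup) =
      QuotientGroup.mk k⁻¹ := by
    refine QuotientGroup.eq.2 ?_
    rw [quotientSubgroup_quasiSplit, hk, mul_inv_rev, inv_inv, ← mul_assoc, inv_mul_cancel, one_mul]
    exact Subgroup.inv_mem _ ⟨γ₀, rfl⟩
  have hrew : ∑' s : (((↑) : (quasiSplit F E c 3).arithmeticSubgroup → (quasiSplit F E c 3).Adelic) '' (cl ⁻¹' {i})),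
      (‖f (g * (s : (quasiSplit F E c 3).Adelic) * g⁻¹)‖ₑ : ℝ≥0∞) =
      ∑' s : (((↑) : (quasiSplit F E c 3).arithmeticSubgroup → (quasiSplit F E c 3).Adelic) '' (cl ⁻¹' {i})),
      (‖f (k⁻¹ * (s : (quasiSplit F E c 3).Adelic) * k⁻¹⁻¹)‖ₑ : ℝ≥0∞) := by
    have h1 := conjTsum_mk (quasiSplit F E c 3).quotientSubgroup _ hS (fun g => (‖f g‖ₑ : ℝ≥0∞)) g
    have h2 := conjTsum_mk (quasiSplit F E c 3).quotientSubgroup _ hS (fun g => (‖f g‖ₑ : ℝ≥0∞)) k⁻¹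
    rw [← h1, ← h2, hkg]
  rw [hrew, inv_inv]
  -- enlarge the index set to all of `G(F)` and bound term by term on the finite set `T`
  calc ∑' s : (((↑) : (quasiSplit F E c 3).arithmeticSubgroup → (quasiSplit F E c 3).Adelic) '' (cl ⁻¹' {i})),
        (‖f (k⁻¹ * (s : (quasiSplit F E c 3).Adelic) * k)‖ₑ : ℝ≥0∞)
      ≤ ∑' s : ((quasiSplit F E c 3).arithmeticSubgroup : Set (quasiSplit F E c 3).Adelic),
          (‖f (k⁻¹ * (s : (quasiSplit F E c 3).Adelic) * k)‖ₑ : ℝ≥0∞) :=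
        ENNReal.tsum_mono_subtype (fun s : (quasiSplit F E c 3).Adelic => (‖f (k⁻¹ * s * k)‖ₑ : ℝ≥0∞))
          (by rintro _ ⟨γ, -, rfl⟩; exact γ.2)
    _ = ∑' γ : (quasiSplit F E c 3).arithmeticSubgroup,
          (‖f (k⁻¹ * (γ : (quasiSplit F E c 3).Adelic) * k)‖ₑ : ℝ≥0∞) := rfl
    _ = ∑ γ ∈ T, (‖f (k⁻¹ * (γ : (quasiSplit F E c 3).Adelic) * k)‖ₑ : ℝ≥0∞) := by
        refine tsum_eq_sum fun γ hγT => ?_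
        have hγC : γ ∉ {γ : (quasiSplit F E c 3).arithmeticSubgroup |
            (1 : (quasiSplit F E c 3).Adelic)⁻¹ * (γ : (quasiSplit F E c 3).Adelic) * 1 ∈ Kc * tsupport f * Kc⁻¹} := by
          intro h; exact hγT ((Set.Finite.mem_toFinset _).2 h)
        have hnot : k⁻¹ * (γ : (quasiSplit F E c 3).Adelic) * k ∉ tsupport f := by
          intro h
          apply hγC
          change (1 : (quasiSplit F E c 3).Adelic)⁻¹ * (γ : (quasiSplit F E c 3).Adelic) * 1 ∈ Kc * tsupport f * Kc⁻¹
          rw [inv_one, one_mul, mul_one,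
            show (γ : (quasiSplit F E c 3).Adelic) = k * (k⁻¹ * (γ : (quasiSplit F E c 3).Adelic) * k) * k⁻¹ by group]
          exact Set.mul_mem_mul (Set.mul_mem_mul hγ₀ h) (Set.inv_mem_inv.2 hγ₀)
        rw [image_eq_zero_of_notMem_tsupport hnot, enorm_zero]
    _ ≤ ∑ γ ∈ T, ENNReal.ofReal M := Finset.sum_le_sum fun γ _ => by
        rw [← ofReal_norm]; exact ENNReal.ofReal_le_ofReal (hM _)
    _ = (T.card : ℝ≥0∞) * ENNReal.ofReal M := by rw [Finset.sum_const, nsmul_eq_mul]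

/-- **`∫⁻_{G(F)\G(𝔸)} Σ_{γ ∈ 𝔬} ‖f(x γ x⁻¹)‖ₑ dμ(x) < ∞` FOR AN ELLIPTIC CLASS `𝔬`** — the absolute-convergence
input of the per-class unfolding of the truncated trace (for `𝔬` off `B(F)`, `k^T_𝔬 = K_𝔬`, ★
`UnitaryGroupTruncatedKernelClassOffBorel`): every automorphic measure is finite and the class sum is bounded.
[cite: Arthur1978TraceFormulaI, §8] [cite: Rogawski1990, §2.2 (p. 13)] -/
theorem lintegral_conjTsum_fiber_enorm_lt_top (hc : c * c = 1)
    {cl : (quasiSplit F E c 3).arithmeticSubgroup → ι} (hcl : IsConjInvariant cl) {i : ι}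
    (hi : ∀ β : (quasiSplit F E c 3).arithmeticSubgroup, β ∈ arithmeticBorel F E c 3 → cl β ≠ i)
    (hS : ∀ ℓ ∈ (quasiSplit F E c 3).quotientSubgroup,
      ∀ s ∈ ((↑) : (quasiSplit F E c 3).arithmeticSubgroup → (quasiSplit F E c 3).Adelic) '' (cl ⁻¹' {i}),
        ℓ * s * ℓ⁻¹ ∈ ((↑) : (quasiSplit F E c 3).arithmeticSubgroup → (quasiSplit F E c 3).Adelic) '' (cl ⁻¹' {i}))
    {f : (quasiSplit F E c 3).Adelic → ℂ} (hfc : Continuous f) (hfs : HasCompactSupport f)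
    [MeasurableSpace ((quasiSplit F E c 3).Adelic ⧸ (quasiSplit F E c 3).quotientSubgroup)]
    (μ : Measure ((quasiSplit F E c 3).Adelic ⧸ (quasiSplit F E c 3).quotientSubgroup)) [IsFiniteMeasure μ] :
    ∫⁻ x, conjTsum (quasiSplit F E c 3).quotientSubgroup
        (((↑) : (quasiSplit F E c 3).arithmeticSubgroup → (quasiSplit F E c 3).Adelic) '' (cl ⁻¹' {i})) hS
        (fun g => (‖f g‖ₑ : ℝ≥0∞)) x ∂μ < ∞ := by
  obtain ⟨B, hB, hle⟩ := exists_forall_conjTsum_fiber_enorm_le hc hcl hi hS hfc hfs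
  calc ∫⁻ x, conjTsum (quasiSplit F E c 3).quotientSubgroup
        (((↑) : (quasiSplit F E c 3).arithmeticSubgroup → (quasiSplit F E c 3).Adelic) '' (cl ⁻¹' {i})) hS
        (fun g => (‖f g‖ₑ : ℝ≥0∞)) x ∂μ
      ≤ ∫⁻ _x, B ∂μ := lintegral_mono fun x => hle x
    _ = B * μ Set.univ := lintegral_const B
    _ < ∞ := ENNReal.mul_lt_top hB.lt_top (measure_lt_top μ _)

end UnitaryGroup

end Literature.NumberTheory.Automorphic
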